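import Summits.BirchSwinnertonDyer.BirchSwinnertonDyer.Theorems.BiquadraticEisensteinDescentHeegnerTwistCouplingInSupplyNonNullBasics
import Summits.BirchSwinnertonDyer.BirchSwinnertonDyer.Theorems.GoldfeldAllTwistsX049PrimeTwistsNull
import Literature.NumberTheory.QuadraticFields.AmbiguousClasses
import HarnessLib

set_option linter.dupNamespace false -- `Summit.BirchSwinnertonDyer.BirchSwinnertonDyer.Theorems.…` (summit = sub, D-0017)
set_option autoImplicit false

/-!
# Crux `HeegnerTwistCouplingInSupply` (stmt-BirchSwinnertonDyer-21381): the shape of C⁺ is FALSE at `p = 2` —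
# `2 ∤ h(K′)` forces `ω(|d_{K′}|) ≤ 1` (Gauss's genus theory) and such integers are a NULL set of square-free integers

Route `BiquadraticEisensteinDescent` (cell `pub/bsd-wall`; width seat `bsd-wall-cm-bed-w1` g17; theorems only, `--supports 21381`).
CALIBRATION of the research stub C⁺ = `stub_nonNullIndivisibleHeegner` («`∀ N p, N ≠ 0 → p.Prime → 5 ≤ p → ¬ twistDensity S_{N,p} 0`»,
`S_{N,p} d := ∃ K′ imaginary quadratic, d_{K′} = d ∧ 4 < |d| ∧ Heegner(N, K′) ∧ p ∤ h(K′)`): the SAME statement with `p = 2` is false at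
EVERY level `N` — `twistDensity S_{N,2} 0` (`twistDensity_indivisibleHeegner_two`), hence `¬ (∀ N, N ≠ 0 → ¬ twistDensity S_{N,2} 0)`
(`not_nonNullIndivisibleHeegner_shape_two`). So the prime `p` enters C⁺ essentially: any argument for C⁺ must distinguish `p ≥ 3` from
`p = 2` (where indivisibility is GOVERNED by a congruence structure — one prime factor — and governed families are null; compare the
ideation seat's barrier note (v) «forced-indivisibility subfamilies are null», `Cruxes/HeegnerTwistCouplingInSupply/OBSTRUCTIONS-seat1-g22.md` §6).

* §1 ★ `natAbs_discr_prime_of_odd_classNumber` — for an imaginary quadratic `K` with square-free `d_K` and `|d_K| > 1`: `2 ∤ h_K ⟹ |d_K|`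
  is prime. Gauss: `#Cl_K[2] = 2^{t−1}`, `t = ω(|d_K|)` (tree theorem `Quadratic.card_sq_eq_one_classGroup`), and `Cl_K[2] ≤ Cl_K` gives
  `2^{t−1} ∣ h_K`; `h_K` odd forces `t = 1`, and a square-free prime power is a prime.
* §2 ★ `twistDensity_indivisibleHeegner_two`, `not_nonNullIndivisibleHeegner_shape_two` — using the Goldfeld cell's null family
  «integers with at most one prime factor» (`GoldfeldGoodTwists.twistDensity_zero_card_primeFactors_le 1`, sieve; the prime case is its
  `twistDensity_zero_natAbs_prime`) and `…NonNullBasics.twistDensity_zero_mono`.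

HONEST FRAMING: a negative calibration of a VARIANT (`p = 2`) of the registered stub; it refutes nothing that is registered (the stub has
`5 ≤ p`), proves nothing about C⁺ for `p ≥ 5`, the crux, or BSD. No definition, no named fact, no `sorry`; axioms standard.
[cite: Cox2013, §3.B Prop. 3.11, Thm. 3.15 (genus theory: `#Cl_K[2] = 2^{t−1}`)] [cite: arXiv250317619, §1 (densities in quadratic twist families)]
-/

noncomputable section

open scoped Classical
open Finset Filter Topology
open Literature.NumberTheory.QuadraticFields Literature.NumberTheory.QuadraticFields.Quadratic Literature.NumberTheory.EllipticCurves
open Summit.BirchSwinnertonDyer.BirchSwinnertonDyer.Theorems.InertBadSignedBranchesInertBadAtThreeNonNullOddHeegner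
open Summit.BirchSwinnertonDyer.BirchSwinnertonDyer.Theorems.BiquadraticEisensteinDescentHeegnerTwistCouplingInSupplyNonNullBasics
open Summit.BirchSwinnertonDyer.BirchSwinnertonDyer.Theorems

namespace Summit.BirchSwinnertonDyer.BirchSwinnertonDyer.Theorems.BiquadraticEisensteinDescentHeegnerTwistCouplingInSupplyNonNullFailsAtTwo

/-! ## §1 Genus theory: odd class number forces a prime discriminant -/

/-- **`2^{t−1} ∣ h_K`** for an imaginary quadratic field `K`, `t = ω(|d_K|)` the number of prime divisors of the discriminant (the
`2`-torsion `Cl_K[2]`, of order `2^{t−1}` by Gauss, is a subgroup of `Cl_K`). [cite: Cox2013, §3.B Prop. 3.11, Thm. 3.15] -/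
theorem two_pow_card_primeFactors_sub_one_dvd_classNumber {K : Type*} [Field K] [NumberField K] (hK : IsImaginaryQuadratic K) :
    2 ^ ((NumberField.discr K).natAbs.primeFactors.card - 1) ∣ NumberField.classNumber K := by
  rw [← card_sq_eq_one_classGroup hK]
  set f : ClassGroup (NumberField.RingOfIntegers K) →* ClassGroup (NumberField.RingOfIntegers K) := powMonoidHom 2 with hf
  have hker : Nat.card f.ker = Nat.card {g : ClassGroup (NumberField.RingOfIntegers K) // g ^ 2 = 1} :=
    Nat.card_congr (Equiv.subtypeEquivRight fun g ↦ by rw [MonoidHom.mem_ker, hf, powMonoidHom_apply])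
  rw [← hker, NumberField.classNumber, ← Nat.card_eq_fintype_card]
  exact Subgroup.card_subgroup_dvd_card f.ker

/-- **Odd class number forces at most one prime divisor of the discriminant**: `2 ∤ h_K ⟹ ω(|d_K|) ≤ 1`.
[cite: Cox2013, §3.B Prop. 3.11, Thm. 3.15] -/
theorem card_primeFactors_le_one_of_not_two_dvd_classNumber {K : Type*} [Field K] [NumberField K] (hK : IsImaginaryQuadratic K)
    (h2 : ¬ 2 ∣ NumberField.classNumber K) : (NumberField.discr K).natAbs.primeFactors.card ≤ 1 := by
  by_contra h
  have hdvd := two_pow_card_primeFactors_sub_one_dvd_classNumber hK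
  have h1 : (NumberField.discr K).natAbs.primeFactors.card - 1 ≠ 0 := by omega
  exact h2 ((dvd_pow_self 2 h1).trans hdvd)

/-- ★ **Odd class number forces a PRIME discriminant** (square-free case): for an imaginary quadratic `K` whose discriminant is
square-free with `|d_K| > 1`, `2 ∤ h_K ⟹ |d_K|` is prime (`ω(|d_K|) = 1` makes `|d_K|` a prime power, and a square-free prime power
is a prime). [cite: Cox2013, §3.B Prop. 3.11, Thm. 3.15] -/
theorem natAbs_discr_prime_of_not_two_dvd_classNumber {K : Type*} [Field K] [NumberField K] (hK : IsImaginaryQuadratic K)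
    (hsf : Squarefree (NumberField.discr K).natAbs) (h1 : 1 < (NumberField.discr K).natAbs)
    (h2 : ¬ 2 ∣ NumberField.classNumber K) : (NumberField.discr K).natAbs.Prime := by
  set n := (NumberField.discr K).natAbs with hn
  have hle := card_primeFactors_le_one_of_not_two_dvd_classNumber hK h2
  have hpos : 0 < n.primeFactors.card := by
    rw [Finset.card_pos, Nat.nonempty_primeFactors]
    exact h1
  have hcard : n.primeFactors.card = 1 := le_antisymm hle hpos
  obtain ⟨q, k, hq, hk, hqk⟩ := (isPrimePow_iff_card_primeFactors_eq_one.mpr hcard)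
  rw [← hqk] at hsf ⊢
  have hq' : q.Prime := Nat.prime_iff.mpr hq
  have hk1 : k = 1 := ((Nat.squarefree_pow_iff hq'.ne_one (Nat.pos_iff_ne_zero.mp hk)).mp hsf).2
  rw [hk1, pow_one]
  exact hq'

/-! ## §2 C⁺ fails at `p = 2` -/

/-- ★ **The `2`-indivisible Heegner discriminants are a NULL set, at every level `N`**: the set counted by C⁺ at `p = 2` consists of
square-free `d = d_{K′}` with `h(K′)` odd, hence `ω(|d|) ≤ 1` — a null set (sieve). [cite: Cox2013, §3.B Prop. 3.11, Thm. 3.15] -/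
theorem twistDensity_indivisibleHeegner_two (N : ℕ) :
    twistDensity (fun d : ℤ ↦ ∃ (K : Type) (_ : Field K) (_ : NumberField K),
      IsImaginaryQuadratic K ∧ NumberField.discr K = d ∧ 4 < d.natAbs ∧
      SatisfiesHeegnerHypothesis N K ∧ ¬ 2 ∣ NumberField.classNumber K) 0 := by
  refine twistDensity_zero_mono (fun d _ hP ↦ ?_) (GoldfeldGoodTwists.twistDensity_zero_card_primeFactors_le 1)
  obtain ⟨K, _, _, hK, hdK, -, -, h2⟩ := hP
  rw [← hdK]
  exact card_primeFactors_le_one_of_not_two_dvd_classNumber hK h2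

/-- ★ **The shape of `stub_nonNullIndivisibleHeegner` is FALSE at `p = 2`**: it is not the case that for every level `N ≠ 0` the
`2`-indivisible Heegner discriminants are non-null (indeed they are null for every `N`, e.g. `N = 1`). The registered stub (with `5 ≤ p`)
is untouched. [cite: Cox2013, §3.B Prop. 3.11, Thm. 3.15] -/
theorem not_nonNullIndivisibleHeegner_shape_two :
    ¬ (∀ N : ℕ, N ≠ 0 → ¬ twistDensity (fun d : ℤ ↦ ∃ (K : Type) (_ : Field K) (_ : NumberField K),
      IsImaginaryQuadratic K ∧ NumberField.discr K = d ∧ 4 < d.natAbs ∧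
      SatisfiesHeegnerHypothesis N K ∧ ¬ 2 ∣ NumberField.classNumber K) 0) :=
  fun h ↦ h 1 one_ne_zero (twistDensity_indivisibleHeegner_two 1)

end Summit.BirchSwinnertonDyer.BirchSwinnertonDyer.Theorems.BiquadraticEisensteinDescentHeegnerTwistCouplingInSupplyNonNullFailsAtTwo

end
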